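import Mathlib
import Summits.ValiantsHypothesis.ValiantsHypothesis.Theorems.NewtonUnitEquationsTwoProductsFormalLogLinearisationShiftRankCell
import HarnessLib

/-!
# Route NewtonUnitEquations — crux `TwoProducts` (stmt-ValiantsHypothesis-5906), line `relation_ladder`, rung R6:
# the tool `BinExpPencilCount` — pencil-visible points of an exponential-BINOMIAL sum are quasi-polynomially few

Helper mode (`--supports stmt-ValiantsHypothesis-5906 --as helper`, no stub credit claimed; val-lit-p3 g14).  This is
the R6 TOOL of val-idea-8 g3's `Cruxes/TwoProducts/Lines/relation_ladder_R6_tool.lean` (interface of record, rev 3: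
Segre lift + ω-slicing reduce the four-term rank-one rung `RankOneLaw` to it): `ExpSum.pencilCount` (p595517 lineage)
with the pure characters `a^ν` replaced by the BINOMIAL characters `C(ν, d)·a^{ν−d}` (products of these over the
coordinates, summed with coefficients) and the number of terms `|κ|` replaced by the width `N = Σ_k ∏_i (d_{ki} + 1)`.
The base `a = 0` is allowed (then `C(ν,d)·0^{ν−d} = [ν = d]`, the shifted indicator of the missing-letter case).

* `BinExpSum.binChar_add` — the Vandermonde addition formula
  `C(β+w, d) a^{β+w−d} = Σ_{p ≤ d} C(β,p) a^{β−p} · C(w,d−p) a^{w−(d−p)}`;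
* `BinExpSum.binProd_add` — its multivariate form (expansion over the box `p ≤ d`);
* `BinExpSum.shift_eq` — an exponential-binomial sum has FINITE SHIFT RANK `N`:
  `F(β + w) = Σ_{(k,p) : p ≤ d_k} (c_k ∏ C(β_i,p_i) a_{ki}^{β_i−p_i}) · ∏ C(w_i, d_{ki}−p_i) a_{ki}^{w_i−d_{ki}+p_i}`;
* `BinExpSum.card_shiftIdx` — the index set `{(k,p) : p ≤ d_k}` has `N` elements;
* `BinExpSum.pencilCount` — hence (`ShiftRank.pencilCount`) every finite set of pencil-visible points of `F` has at most
  `2(s²+1)·(log₂ N + 1)·N^{2 log₂ N}` elements;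
* `BinExpSum.pencilCount_arith` + **`BinExpSum.binExpPencilCount`** — the literal body of the interface
  `R6Tool.BinExpPencilCount` with witness `A = 3`:
  `#S ≤ (s+2)^3 · (N+2)^{3 (log₂(N+2) + 1)}` (the line owner wires `stub_binExpPencilCount` by `exact`).

Honest framing: an elementary tool (linear algebra + counting) for the THEORY lane of the `relation_ladder` line; the
rung `RankOneLaw`, the residual law and the crux `TwoProducts` (stmt-5906) stay OPEN, no rung of record moves, and
nothing here is progress on `VP ≠ VNP` (NOT proved).  No definitions, no named facts. [folklore]
-/

noncomputable section

-- Sub = Summit single-conjunct layout: the duplicated namespace component is mandated by the tree.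
set_option linter.dupNamespace false

namespace Summit.ValiantsHypothesis.ValiantsHypothesis.Theorems.NewtonUnitEquations.TwoProducts.FormalLogLinearisation

open scoped BigOperators

namespace BinExpSum

variable {s : ℕ}

/-- **Vandermonde addition formula for binomial characters.**
`C(β+w, d)·a^{β+w−d} = Σ_{p=0}^{d} (C(β,p) a^{β−p}) · (C(w,d−p) a^{w−(d−p)})` (terms with `p > β` or `d − p > w`
vanish on both readings). [folklore] -/
theorem binChar_add (a : ℂ) (d β w : ℕ) :
    (((β + w).choose d : ℕ) : ℂ) * a ^ (β + w - d) =
      ∑ p ∈ Finset.range (d + 1),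
        (((β.choose p : ℕ) : ℂ) * a ^ (β - p)) * (((w.choose (d - p) : ℕ) : ℂ) * a ^ (w - (d - p))) := by
  have h := Finset.Nat.sum_antidiagonal_eq_sum_range_succ
    (fun p q => (((β.choose p : ℕ) : ℂ) * a ^ (β - p)) * (((w.choose q : ℕ) : ℂ) * a ^ (w - q))) d
  rw [Nat.succ_eq_add_one] at h
  rw [← h, Nat.add_choose_eq]
  push_cast
  rw [Finset.sum_mul]
  refine Finset.sum_congr rfl fun pq hpq => ?_
  have hd : pq.1 + pq.2 = d := Finset.HasAntidiagonal.mem_antidiagonal.mp hpq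
  by_cases h1 : β < pq.1
  · simp [Nat.choose_eq_zero_of_lt h1]
  by_cases h2 : w < pq.2
  · simp [Nat.choose_eq_zero_of_lt h2]
  push Not at h1 h2
  have hpow : a ^ (β + w - d) = a ^ (β - pq.1) * a ^ (w - pq.2) := by
    rw [← pow_add]; congr 1; omega
  rw [hpow]; ring

/-- **Multivariate Vandermonde.**  `∏_i C(β_i+w_i, d_i) a_i^{β_i+w_i−d_i} =
Σ_{p ≤ d} (∏_i C(β_i,p_i) a_i^{β_i−p_i}) · ∏_i C(w_i, d_i−p_i) a_i^{w_i−(d_i−p_i)}` (sum over the box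
`piFinset (range (d_i+1))`). [folklore] -/
theorem binProd_add (a : Fin s → ℂ) (d β w : Fin s → ℕ) :
    ∏ i, ((((β i + w i).choose (d i) : ℕ) : ℂ) * a i ^ (β i + w i - d i)) =
      ∑ p ∈ Fintype.piFinset (fun i => Finset.range (d i + 1)),
        (∏ i, (((β i).choose (p i) : ℕ) : ℂ) * a i ^ (β i - p i)) *
          ∏ i, ((((w i).choose (d i - p i) : ℕ) : ℂ) * a i ^ (w i - (d i - p i))) := by
  classical
  simp_rw [binChar_add, ← Finset.prod_mul_distrib]
  exact Finset.prod_univ_sum (fun i => Finset.range (d i + 1))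
    (fun i q => (((β i).choose q : ℕ) : ℂ) * a i ^ (β i - q) * ((((w i).choose (d i - q) : ℕ) : ℂ) * a i ^ (w i - (d i - q))))

/-- **The shift index set `{(k, p) : p ≤ d_k}` has `N = Σ_k ∏_i (d_{ki} + 1)` elements.** [folklore] -/
theorem card_shiftIdx {κ : Type*} [Fintype κ] (d : κ → Fin s → ℕ) :
    Fintype.card ↥(Finset.univ.sigma fun k => Fintype.piFinset fun i => Finset.range (d k i + 1)) =
      ∑ k, ∏ i, (d k i + 1) := by
  rw [Fintype.card_coe, Finset.card_sigma]
  refine Finset.sum_congr rfl fun k _ => ?_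
  rw [Fintype.card_piFinset]
  simp

/-- **An exponential-binomial sum has finite shift rank `N`.**  With `F(ν) = Σ_k c_k ∏_i C(ν_i,d_{ki}) a_{ki}^{ν_i−d_{ki}}`:
`F(β + w) = Σ_{(k,p) : p ≤ d_k} (c_k ∏_i C(β_i,p_i) a_{ki}^{β_i−p_i}) · ∏_i C(w_i,d_{ki}−p_i) a_{ki}^{w_i−(d_{ki}−p_i)}`.
[folklore] -/
theorem shift_eq {κ : Type*} [Fintype κ] (c : κ → ℂ) (a : κ → Fin s → ℂ) (d : κ → Fin s → ℕ)
    (β w : Fin s → ℕ) :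
    (fun ν : Fin s → ℕ => ∑ k, c k * ∏ i, ((((ν i).choose (d k i) : ℕ) : ℂ) * a k i ^ (ν i - d k i))) (β + w) =
      ∑ x : ↥(Finset.univ.sigma fun k => Fintype.piFinset fun i => Finset.range (d k i + 1)),
        (c x.1.1 * ∏ i, ((((β i).choose (x.1.2 i) : ℕ) : ℂ) * a x.1.1 i ^ (β i - x.1.2 i))) *
          ∏ i, ((((w i).choose (d x.1.1 i - x.1.2 i) : ℕ) : ℂ) * a x.1.1 i ^ (w i - (d x.1.1 i - x.1.2 i))) := by
  classical
  rw [Finset.sum_coe_sort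
    (f := fun x : (Σ _ : κ, (Fin s → ℕ)) =>
      (c x.1 * ∏ i, ((((β i).choose (x.2 i) : ℕ) : ℂ) * a x.1 i ^ (β i - x.2 i))) *
        ∏ i, ((((w i).choose (d x.1 i - x.2 i) : ℕ) : ℂ) * a x.1 i ^ (w i - (d x.1 i - x.2 i)))),
    Finset.sum_sigma]
  refine Finset.sum_congr rfl fun k _ => ?_
  simp only [Pi.add_apply]
  rw [binProd_add, Finset.mul_sum]
  exact Finset.sum_congr rfl fun p _ => by ring

/-- **PENCIL COUNT for exponential-binomial sums.**  For `F(ν) = Σ_{k∈κ} c_k ∏_i C(ν_i, d_{ki}) a_{ki}^{ν_i − d_{ki}}`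
on `ℕ^s` (`a_{ki} = 0` allowed) and any real pencil `u + t·v`, every finite set of points `μ` with `F(μ) ≠ 0`, each the
STRICT `(u + t v)`-minimiser of `{F ≠ 0}` for some real `t`, has at most `2(s²+1)·(log₂ N + 1)·N^{2 log₂ N}` elements,
`N = Σ_k ∏_i (d_{ki} + 1)`. [folklore] -/
theorem pencilCount {κ : Type*} [Fintype κ] (c : κ → ℂ) (a : κ → Fin s → ℂ) (d : κ → Fin s → ℕ)
    (u v : Fin s → ℝ) (S : Finset (Fin s → ℕ))
    (hS : ∀ μ ∈ S, (∑ k, c k * ∏ i, ((((μ i).choose (d k i) : ℕ) : ℂ) * a k i ^ (μ i - d k i))) ≠ 0 ∧ ∃ t : ℝ,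
      ∀ ν : Fin s → ℕ, ν ≠ μ → (∑ k, c k * ∏ i, ((((ν i).choose (d k i) : ℕ) : ℂ) * a k i ^ (ν i - d k i))) ≠ 0 →
        ∑ i, (u i + t * v i) * (μ i : ℝ) < ∑ i, (u i + t * v i) * (ν i : ℝ)) :
    S.card ≤ 2 * (s * s + 1) * ((Nat.log 2 (∑ k, ∏ i, (d k i + 1)) + 1) *
      (∑ k, ∏ i, (d k i + 1)) ^ (2 * Nat.log 2 (∑ k, ∏ i, (d k i + 1)))) := by
  classical
  rw [← card_shiftIdx d]
  exact ShiftRank.pencilCount (fun β w => shift_eq c a d β w) u v S hS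

/-- Arithmetic: `2(s²+1)·((L+1)·N^{2L}) ≤ (s+2)^3·(N+2)^{3(log₂(N+2)+1)}` for `L = log₂ N`. [folklore] -/
theorem pencilCount_arith (s N : ℕ) :
    2 * (s * s + 1) * ((Nat.log 2 N + 1) * N ^ (2 * Nat.log 2 N)) ≤
      (s + 2) ^ 3 * (N + 2) ^ (3 * (Nat.log 2 (N + 2) + 1)) := by
  have hs : 2 * (s * s + 1) ≤ (s + 2) ^ 3 := by
    have h1 : s * s + 1 ≤ (s + 2) * (s + 2) := by nlinarith
    calc 2 * (s * s + 1) ≤ (s + 2) * ((s + 2) * (s + 2)) := Nat.mul_le_mul (by omega) h1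
      _ = (s + 2) ^ 3 := by ring
  have hL : Nat.log 2 N ≤ Nat.log 2 (N + 2) := Nat.log_mono_right (by omega)
  have hL1 : Nat.log 2 N + 1 ≤ N + 2 := by
    have := Nat.log_le_self 2 N
    omega
  have hN : N ^ (2 * Nat.log 2 N) ≤ (N + 2) ^ (2 * Nat.log 2 (N + 2)) :=
    calc N ^ (2 * Nat.log 2 N) ≤ (N + 2) ^ (2 * Nat.log 2 N) := Nat.pow_le_pow_left (by omega) _
      _ ≤ (N + 2) ^ (2 * Nat.log 2 (N + 2)) := Nat.pow_le_pow_right (by omega) (by omega)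
  have hmid : (Nat.log 2 N + 1) * N ^ (2 * Nat.log 2 N) ≤ (N + 2) ^ (3 * (Nat.log 2 (N + 2) + 1)) :=
    calc (Nat.log 2 N + 1) * N ^ (2 * Nat.log 2 N)
        ≤ (N + 2) * (N + 2) ^ (2 * Nat.log 2 (N + 2)) := Nat.mul_le_mul hL1 hN
      _ = (N + 2) ^ (2 * Nat.log 2 (N + 2) + 1) := by ring
      _ ≤ (N + 2) ^ (3 * (Nat.log 2 (N + 2) + 1)) := Nat.pow_le_pow_right (by omega) (by omega)
  exact Nat.mul_le_mul hs hmid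

/-- **`BinExpPencilCount` (R6 tool of the `relation_ladder` line; literal body of
`Cruxes/TwoProducts/Lines/relation_ladder_R6_tool.lean :: R6Tool.BinExpPencilCount`, witness `A = 3`).**  For every
exponential-binomial sum `F(ν) = Σ_{k<n} c_k ∏_{i<s} C(ν_i, d_{ki}) a_{ki}^{ν_i − d_{ki}}` on `ℕ^s` and every real pencil
`u + t·v`, a finite set of points `μ` with `F(μ) ≠ 0`, each the strict `(u + t v)`-minimiser of `{F ≠ 0}` for some
`t`, has at most `(s+2)^A · (N+2)^{A (log₂(N+2) + 1)}` elements, `N = Σ_k ∏_i (d_{ki} + 1)`. [folklore] -/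
theorem binExpPencilCount :
    ∃ A : ℕ, ∀ (s n : ℕ) (c : Fin n → ℂ) (a : Fin n → Fin s → ℂ) (d : Fin n → Fin s → ℕ) (u v : Fin s → ℝ)
      (S : Finset (Fin s → ℕ)),
      (∀ μ ∈ S, (∑ k, c k * ∏ i, ((μ i).choose (d k i) : ℂ) * a k i ^ (μ i - d k i)) ≠ 0 ∧ ∃ t : ℝ,
        ∀ ν : Fin s → ℕ, ν ≠ μ → (∑ k, c k * ∏ i, ((ν i).choose (d k i) : ℂ) * a k i ^ (ν i - d k i)) ≠ 0 →
          ∑ i, (u i + t * v i) * (μ i : ℝ) < ∑ i, (u i + t * v i) * (ν i : ℝ)) →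
      S.card ≤ (s + 2) ^ A * (∑ k, ∏ i, (d k i + 1) + 2) ^ (A * (Nat.log 2 (∑ k, ∏ i, (d k i + 1) + 2) + 1)) :=
  ⟨3, fun s _ c a d u v S hS => (pencilCount c a d u v S hS).trans (pencilCount_arith s _)⟩

end BinExpSum

end Summit.ValiantsHypothesis.ValiantsHypothesis.Theorems.NewtonUnitEquations.TwoProducts.FormalLogLinearisation

end
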